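import Summits.NavierStokesRegularity.TurbBounds.Results.N0Tail
import Summits.NavierStokesRegularity.TurbBounds.RBSpectralLink
import HarnessLib

/-!
# Row RB-N0 from the CITED reduction ALONE: `SpectralReduction Nu → Nu(1000) ≤ 1`, and the spectral constraint (A1) itself, unconditional
(cell `pub-turb` / `turb-bounds`, v2 lane; composition file — needs pub-turb-sos's staged `SpectralForm.lean` (the cited statement) in the tree,
this seat's `RBSpectralLink` and `Results/N0Tail`. Written by pub-turb-cert, prover-pub-turb-cert-g6-0.)

HONEST FRAMING: rigorous bounds for the stated PDE and boundary conditions; no claim about physical turbulence beyond the bound.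
RESULT: `N0.spectralConstraint_holds : SpectralConstraint 1000 3 (fun _ => -1)` — for the conduction background (`τ′ ≡ −1`) at
`Ra = 1000` with balance parameter `s = 3`, the full-gap mode form `Q_k[w, θ]` of the affine background method is `≥ 0` for EVERY `k > 0`
on the two-sided no-slip class — UNCONDITIONAL (certificate + interval lemmas + tail lemma + density + cutoff, all kernel-checked);
`N0.nusselt_bound_of_spectralReduction (h : SpectralReduction Nu) : Nu 1000 ≤ 1` — CERTIFIED.md row RB-N0 ('Nu ≤ 1 at Ra = 10³, every
Pr, every horizontal period / lattice, d = 2, 3') from ONE hypothesis which is the published reduction transcribed mode-wise from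
[cite: DingKerswell2019, (13)–(16)] / [DC96] (decision 112 (C): a transcription). NOT CLAIMED: the PDE energy argument (A1) ⇒ Nusselt bound (that IS the hypothesis).
-/

set_option linter.style.longLine false

noncomputable section

namespace Summit.NavierStokesRegularity.TurbBounds.Results.N0

open MeasureTheory intervalIntegral
open Summit.NavierStokesRegularity.TurbBounds.SpectralForm
open Summit.NavierStokesRegularity.TurbBounds.TailTwoSided (RBPositivity)
open Summit.NavierStokesRegularity.TurbBounds.RBSpectralLink (spectralConstraint_of_rbPositivity)
open Summit.NavierStokesRegularity.TurbBounds.Certs.N0.Evaluator (Ra a0 s ghat0)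

/-- **(A1) for row RB-N0, unconditional.** -/
theorem spectralConstraint_holds : SpectralConstraint 1000 3 (fun _ => -1) := by
  apply spectralConstraint_of_rbPositivity
  have h := TailN0.rbPositivity_holds
  have ea : ((a0 : ℚ) : ℝ) = ((3 : ℝ) - 1) / 1000 := by norm_num [a0, s, Ra]
  have es : ((s : ℚ) : ℝ) = (3 : ℝ) := by norm_num [s]
  have eg : (fun _ : ℝ => ((ghat0 : ℚ) : ℝ)) = (fun y : ℝ => (3 : ℝ) * (fun _ : ℝ => (-1 : ℝ)) ((y + 1) / 2)) := by
    funext y; norm_num [ghat0, s]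
  rw [ea, es, eg] at h
  exact h

/-- The conduction background `τ′ ≡ −1` is an admissible profile of the cited theorem (`∫₀¹ τ′ = −1`, `τ′ ∈ L¹ ∩ L²`). -/
theorem profile_conduction : Profile (fun _ : ℝ => (-1 : ℝ)) where
  integrable := intervalIntegrable_const
  sq_integrable := by simp
  total := by simp

/-- **ROW RB-N0 from the cited theorem alone**: for every quantity `Nu` obeying the affine background-method reduction in mode form
(`SpectralReduction`), `Nu(1000) ≤ 1` (every Pr, every horizontal period / lattice, d = 2, 3). -/
theorem nusselt_bound_of_spectralReduction (Nu : ℝ → ℝ) (h : SpectralReduction Nu) : Nu 1000 ≤ 1 := by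
  have hb := h 1000 3 (fun _ => -1) (by norm_num) (by norm_num) profile_conduction spectralConstraint_holds
  have hi : (∫ z in (0 : ℝ)..1, ((fun _ : ℝ => (-1 : ℝ)) z) ^ 2) = 1 := by simp
  rw [hi] at hb
  linarith

end Summit.NavierStokesRegularity.TurbBounds.Results.N0

end
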